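import Mathlib.LinearAlgebra.BilinearForm.Properties
import Mathlib.LinearAlgebra.Matrix.Trace
import Mathlib.Data.Matrix.Basis
import Mathlib.LinearAlgebra.FiniteDimensional.Lemmas
import Mathlib.LinearAlgebra.Dual.Lemmas
import Literature.Computability.AlgebraicComplexity.SmallFormatRankFlag
import HarnessLib

/-!
# Bilinear computations for `3 × 3` matrix multiplication: set-up (Bläser 2003, §3–§4)

Topic `Literature/Computability/AlgebraicComplexity`. Infrastructure for the proof of
Bläser's bound `R(⟨3,3,3⟩) ≥ 19` [Blaser2003, Cor. 9]:

* `frob A B = ∑ᵢⱼ Aᵢⱼ Bᵢⱼ`, the trace pairing on `K^{3×3}` (a nondegenerate symmetric bilinear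
  form, `frobForm`), through which a linear form on `K^{3×3}` is a matrix;
* `IsComp F G W`: the triple of families `(F_ρ, G_ρ, W_ρ)_ρ` is a *bilinear computation* for
  `⟨3,3,3⟩` (Bläser 2003, Def. 1): `x * y = ∑_ρ ⟪F_ρ, x⟫ ⟪G_ρ, y⟫ W_ρ` for all `x, y` — literally
  a triad decomposition of the tensor `⟨3,3,3⟩`;
* the equivalence transformations of Bläser 2003, §3: transposition (`IsComp.transpose`) and
  sandwiching (`IsComp.sandwich`);
* conciseness of `⟨3,3,3⟩`: the `F_ρ`, the `G_ρ` and the `W_ρ` each span `K^{3×3}`;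
* the flag of subspaces of Bläser 2003, §4 for `c = m = n = 3` (0-indexed), as the instances of
  the general `colZero`, `zSub`, `rowZero` of `SmallFormatRankFlag.lean`: `L1 = colZero K 3 3 1 =
  {col 0 = 0}`, `L2 = colZero K 3 3 2`, `Z1 = zSub K 3 3 1 = {x₀₀ = 0}`, `Z2 = zSub K 3 3 2`,
  `R0 = rowZero K 3 3`, with entrywise membership lemmas, and two further subspaces
  `Srow = {rows 0,1 = 0}`, `Y = {x₀₀ = x₀₁ = 0}`; the coordinate maps `col0`, `cols01`, `row0`,
  `rows01`, `entry`, `π4 = (x₁₀,x₂₀,x₁₁,x₂₁)`, `π2 = (x₁₀,x₂₀)`, `pr42`, the rank-one right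
  ideal map `rk1 v : λ ↦ v λᵀ`;
* the bridge `IsComp.toBilinComp` to the bundled computations `BilinComp (mulBilin K 3 3 3) ι`
  of `SmallFormatRankSubstitution.lean` / `SmallFormatRankFlag.lean`, whose Lemma 3, Extension
  Lemma and Lemma 5 (`blaser2003_lemma5_card`) are used downstream.

Everything here is PROVED (no named facts); all definitions are concrete.
-/

namespace Literature.Computability.AlgebraicComplexity

namespace Blaser2003

open Matrix Module

variable {K : Type*} [Field K]

/-- The space `K^{3×3}` of `3 × 3` matrices. [cite: Blaser2003, §4] -/
abbrev Mat3 (K : Type*) [Field K] := Matrix (Fin 3) (Fin 3) K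

/-! ## The trace pairing -/

/-- The trace pairing `⟪A, B⟫ = ∑ᵢⱼ Aᵢⱼ Bᵢⱼ = tr(Aᵀ B)` on `K^{3×3}`; `x ↦ ⟪A, x⟫` is the general
linear form on `K^{3×3}`. [folklore] -/
def frob (A B : Mat3 K) : K := ∑ i, ∑ j, A i j * B i j

/-- Additivity of `frob` in the first slot. [folklore] -/
theorem frob_add_left (A A' B : Mat3 K) : frob (A + A') B = frob A B + frob A' B := by
  simp only [frob, Matrix.add_apply, add_mul, Finset.sum_add_distrib]

/-- Homogeneity of `frob` in the first slot. [folklore] -/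
theorem frob_smul_left (c : K) (A B : Mat3 K) : frob (c • A) B = c * frob A B := by
  simp only [frob, Matrix.smul_apply, smul_eq_mul, mul_assoc, Finset.mul_sum]

/-- Symmetry of `frob`. [folklore] -/
theorem frob_comm (A B : Mat3 K) : frob A B = frob B A := by
  simp only [frob, mul_comm]

/-- Additivity of `frob` in the second slot. [folklore] -/
theorem frob_add_right (A B B' : Mat3 K) : frob A (B + B') = frob A B + frob A B' := by
  rw [frob_comm, frob_add_left, frob_comm B, frob_comm B']

/-- Homogeneity of `frob` in the second slot. [folklore] -/
theorem frob_smul_right (c : K) (A B : Mat3 K) : frob A (c • B) = c * frob A B := by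
  rw [frob_comm, frob_smul_left, frob_comm]

/-- `frob` vanishes on `0` (second slot). [folklore] -/
@[simp] theorem frob_zero_right (A : Mat3 K) : frob A 0 = 0 := by simp [frob]

/-- `frob` vanishes on `0` (first slot). [folklore] -/
@[simp] theorem frob_zero_left (B : Mat3 K) : frob 0 B = 0 := by simp [frob]

/-- `frob` is compatible with subtraction (second slot). [folklore] -/
theorem frob_sub_right (A B B' : Mat3 K) : frob A (B - B') = frob A B - frob A B' := by
  simp only [frob, Matrix.sub_apply, mul_sub, Finset.sum_sub_distrib]

/-- `frob` is compatible with negation (second slot). [folklore] -/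
theorem frob_neg_right (A B : Mat3 K) : frob A (-B) = -frob A B := by
  simpa using frob_sub_right A 0 B

/-- `frob` commutes with finite sums (second slot). [folklore] -/
theorem frob_sum_right {α : Type*} (s : Finset α) (A : Mat3 K) (B : α → Mat3 K) :
    frob A (∑ a ∈ s, B a) = ∑ a ∈ s, frob A (B a) := by
  classical
  induction s using Finset.induction_on with
  | empty => simp
  | insert a s ha ih => rw [Finset.sum_insert ha, Finset.sum_insert ha, frob_add_right, ih]

/-- Pairing with an elementary matrix extracts an entry. [folklore] -/
theorem frob_single_right (A : Mat3 K) (i j : Fin 3) : frob A (single i j 1) = A i j := by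
  simp only [frob, Fin.sum_univ_three]
  fin_cases i <;> fin_cases j <;> simp

/-- Pairing with an elementary matrix extracts an entry. [folklore] -/
theorem frob_single_left (A : Mat3 K) (i j : Fin 3) : frob (single i j 1) A = A i j := by
  rw [frob_comm, frob_single_right]

/-- Nondegeneracy: a matrix pairing to zero with everything is zero. [folklore] -/
theorem eq_zero_of_frob_right {A : Mat3 K} (h : ∀ B, frob A B = 0) : A = 0 := by
  ext i j; simpa [frob_single_right] using h (single i j 1)

/-- Nondegeneracy in the other slot. [folklore] -/
theorem eq_zero_of_frob_left {B : Mat3 K} (h : ∀ A, frob A B = 0) : B = 0 :=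
  eq_zero_of_frob_right fun A => by rw [frob_comm]; exact h A

/-- `frob` is invariant under transposing both arguments. [folklore] -/
theorem frob_transpose (A B : Mat3 K) : frob Aᵀ Bᵀ = frob A B := by
  simp only [frob, transpose_apply]
  exact Finset.sum_comm

/-- Moving a transpose across the pairing. [folklore] -/
theorem frob_transpose_right (A B : Mat3 K) : frob A Bᵀ = frob Aᵀ B := by
  rw [← frob_transpose, transpose_transpose]

/-- `⟪A, B⟫ = tr(Aᵀ B)`. [folklore] -/
theorem frob_eq_trace (A B : Mat3 K) : frob A B = (Aᵀ * B).trace := by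
  simp only [frob, Matrix.trace, Matrix.diag, Matrix.mul_apply, transpose_apply]
  exact Finset.sum_comm

/-- Sandwiching moves across the pairing: `⟪F, a x b⟫ = ⟪aᵀ F bᵀ, x⟫` (Bläser 2003, §3).
[cite: Blaser2003, §3] -/
theorem frob_mul_mul (F a x b : Mat3 K) : frob F (a * x * b) = frob (aᵀ * F * bᵀ) x := by
  rw [frob_eq_trace, frob_eq_trace, Matrix.transpose_mul, Matrix.transpose_mul,
    transpose_transpose, transpose_transpose,
    show Fᵀ * (a * x * b) = (Fᵀ * a * x) * b by simp only [Matrix.mul_assoc],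
    Matrix.trace_mul_comm]
  simp only [Matrix.mul_assoc]

/-- The trace pairing as a bilinear form. [folklore] -/
def frobForm : LinearMap.BilinForm K (Mat3 K) :=
  LinearMap.mk₂ K frob frob_add_left frob_smul_left frob_add_right frob_smul_right

/-- Unfolding `frobForm`. [folklore] -/
@[simp] theorem frobForm_apply (A B : Mat3 K) : frobForm A B = frob A B := rfl

/-- The trace pairing is nondegenerate. [folklore] -/
theorem frobForm_nondegenerate : (frobForm : LinearMap.BilinForm K (Mat3 K)).Nondegenerate :=
  ⟨fun A h => eq_zero_of_frob_right (by simpa using h),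
    fun B h => eq_zero_of_frob_left (by simpa using h)⟩

/-- The trace pairing is symmetric. [folklore] -/
theorem frobForm_isSymm : (frobForm : LinearMap.BilinForm K (Mat3 K)).IsSymm :=
  ⟨fun A B => by simp [frob_comm]⟩

/-- A family of matrices whose linear forms `⟪F_ρ, ·⟫` have no common zero on `K^{3×3} ∖ 0`
spans `K^{3×3}` (duality through the nondegenerate trace pairing). [folklore] -/
theorem span_eq_top_of_forall_frob {ι : Type*} (F : ι → Mat3 K)
    (h : ∀ z : Mat3 K, z ≠ 0 → ∃ ρ, frob (F ρ) z ≠ 0) :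
    Submodule.span K (Set.range F) = ⊤ := by
  set e := (frobForm : LinearMap.BilinForm K (Mat3 K)).toDual frobForm_nondegenerate with he
  have htop : Submodule.span K (Set.range fun ρ => (frobForm (F ρ) : Module.Dual K (Mat3 K))) =
      ⊤ := by
    refine Submodule.span_eq_top_of_ne_zero fun z hz => ?_
    obtain ⟨ρ, hρ⟩ := h z hz
    exact ⟨_, ⟨ρ, rfl⟩, by simpa using hρ⟩
  have hmap : (Submodule.span K (Set.range F)).map (e : Mat3 K →ₗ[K] Module.Dual K (Mat3 K)) =
      ⊤ := by
    rw [Submodule.map_span, ← Set.range_comp]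
    exact htop
  have := congrArg (Submodule.comap (e : Mat3 K →ₗ[K] Module.Dual K (Mat3 K))) hmap
  rwa [Submodule.comap_map_eq_of_injective e.injective, Submodule.comap_top] at this

/-! ## Bilinear computations for `⟨3,3,3⟩` and their equivalence transformations -/

section Comp

variable {ι : Type*} [Fintype ι]

/-- `(F, G, W)` is a **bilinear computation** for `3 × 3` matrix multiplication (Bläser 2003,
Def. 1, with linear forms written as matrices through the trace pairing):
`x y = ∑_ρ ⟪F_ρ, x⟫ ⟪G_ρ, y⟫ W_ρ` for all `x, y ∈ K^{3×3}`. [cite: Blaser2003, Definition 1] -/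
def IsComp (F G W : ι → Mat3 K) : Prop :=
  ∀ x y : Mat3 K, x * y = ∑ ρ, (frob (F ρ) x * frob (G ρ) y) • W ρ

namespace IsComp

variable {F G W : ι → Mat3 K}

/-- **Transposition** (Bläser 2003, §3): `(Gᵀ, Fᵀ, Wᵀ)` is again a computation for `⟨3,3,3⟩`,
since `x y = (yᵀ xᵀ)ᵀ`. [cite: Blaser2003, §3] -/
theorem transpose (h : IsComp F G W) :
    IsComp (fun ρ => (G ρ)ᵀ) (fun ρ => (F ρ)ᵀ) (fun ρ => (W ρ)ᵀ) := by
  intro x y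
  have hxy := congrArg Matrix.transpose (h yᵀ xᵀ)
  rw [Matrix.transpose_mul, transpose_transpose, transpose_transpose] at hxy
  rw [hxy, Matrix.transpose_sum]
  refine Finset.sum_congr rfl fun ρ _ => ?_
  rw [Matrix.transpose_smul, frob_transpose_right, frob_transpose_right, mul_comm]

/-- **Sandwiching** (Bläser 2003, §3): for invertible `a, b, c`,
`x y = a'(a x b')(b y c')c` turns a computation into the computation
`(aᵀ F_ρ b'ᵀ, bᵀ G_ρ c'ᵀ, a' W_ρ c)_ρ` (`a' = a⁻¹`, `b' = b⁻¹`, `c' = c⁻¹`).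
[cite: Blaser2003, §3] -/
theorem sandwich (h : IsComp F G W) {a a' b b' c c' : Mat3 K} (ha : a' * a = 1)
    (hb : b' * b = 1) (hc : c' * c = 1) :
    IsComp (fun ρ => aᵀ * F ρ * b'ᵀ) (fun ρ => bᵀ * G ρ * c'ᵀ) (fun ρ => a' * W ρ * c) := by
  intro x y
  have key : x * y = a' * ((a * x * b') * (b * y * c')) * c := by
    calc x * y = (a' * a) * x * (b' * b) * y * (c' * c) := by rw [ha, hb, hc]; simp
      _ = a' * ((a * x * b') * (b * y * c')) * c := by simp only [Matrix.mul_assoc]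
  rw [key, h (a * x * b') (b * y * c'), Finset.mul_sum, Finset.sum_mul]
  refine Finset.sum_congr rfl fun ρ _ => ?_
  rw [frob_mul_mul, frob_mul_mul, Matrix.mul_smul, Matrix.smul_mul]

/-- 1-conciseness of `⟨3,3,3⟩`: the forms `⟪F_ρ, ·⟫` have no common zero `x ≠ 0`
(`x = x · 1`). [cite: Blaser2003, §4] -/
theorem eq_zero_of_F (h : IsComp F G W) {x : Mat3 K} (hx : ∀ ρ, frob (F ρ) x = 0) :
    x = 0 := by
  have := h x 1
  rw [Matrix.mul_one] at this
  rw [this]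
  simp [hx]

/-- 2-conciseness of `⟨3,3,3⟩`: the forms `⟪G_ρ, ·⟫` have no common zero `y ≠ 0`.
[cite: Blaser2003, §4] -/
theorem eq_zero_of_G (h : IsComp F G W) {y : Mat3 K} (hy : ∀ ρ, frob (G ρ) y = 0) :
    y = 0 := by
  have := h 1 y
  rw [Matrix.one_mul] at this
  rw [this]
  simp [hy]

/-- The `F_ρ` of a computation span `K^{3×3}`. [cite: Blaser2003, §4] -/
theorem span_F (h : IsComp F G W) : Submodule.span K (Set.range F) = ⊤ :=
  span_eq_top_of_forall_frob F fun z hz => by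
    by_contra hall
    push Not at hall
    exact hz (h.eq_zero_of_F hall)

/-- The `G_ρ` of a computation span `K^{3×3}`. [cite: Blaser2003, §4] -/
theorem span_G (h : IsComp F G W) : Submodule.span K (Set.range G) = ⊤ :=
  span_eq_top_of_forall_frob G fun z hz => by
    by_contra hall
    push Not at hall
    exact hz (h.eq_zero_of_G hall)

/-- 3-conciseness: the `W_ρ` of a computation span `K^{3×3}` (`x = x · 1`).
[cite: Blaser2003, §4] -/
theorem span_W (h : IsComp F G W) : Submodule.span K (Set.range W) = ⊤ := by
  rw [eq_top_iff]
  intro x _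
  rw [show x = x * 1 from (Matrix.mul_one x).symm, h x 1]
  exact Submodule.sum_mem _ fun ρ _ => Submodule.smul_mem _ _ (Submodule.subset_span ⟨ρ, rfl⟩)

end IsComp

/-- The linear forms `⟪F_ρ, ·⟫` of a family of matrices. [cite: Blaser2003, Definition 1] -/
abbrev fF (F : ι → Mat3 K) : ι → Mat3 K →ₗ[K] K := fun ρ => frobForm (F ρ)

/-- A computation in the sense of `IsComp` computes the bilinear map `mulBilin K 3 3 3` of
`SmallFormatRankFlag.lean`. [cite: Blaser2003, Definition 1] -/
theorem IsComp.map_eq_sum {F G W : ι → Mat3 K} (h : IsComp F G W) (u v : Mat3 K) :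
    mulBilin K 3 3 3 u v = ∑ ρ, (fF F ρ u * fF G ρ v) • W ρ := by
  rw [mulBilin_apply]
  exact h u v

/-- The computation `(F, G, W)` as a bundled `BilinComp (mulBilin K 3 3 3) ι`
(`SmallFormatRankSubstitution.BilinComp`): forms `⟪F_ρ, ·⟫`, `⟪G_ρ, ·⟫`, vectors `W_ρ`.
[cite: Blaser2003, Definition 1] -/
def IsComp.toBilinComp {F G W : ι → Mat3 K} (h : IsComp F G W) :
    BilinComp (mulBilin K 3 3 3) ι where
  f := fF F
  g := fF G
  w := W
  map_eq_sum := h.map_eq_sum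

/-- The first forms of `toBilinComp`. [cite: Blaser2003, Definition 1] -/
@[simp] theorem IsComp.toBilinComp_f {F G W : ι → Mat3 K} (h : IsComp F G W) :
    h.toBilinComp.f = fF F := rfl

/-- The second forms of `toBilinComp`. [cite: Blaser2003, Definition 1] -/
@[simp] theorem IsComp.toBilinComp_g {F G W : ι → Mat3 K} (h : IsComp F G W) :
    h.toBilinComp.g = fF G := rfl

/-- The vectors of `toBilinComp`. [cite: Blaser2003, Definition 1] -/
@[simp] theorem IsComp.toBilinComp_w {F G W : ι → Mat3 K} (h : IsComp F G W) :
    h.toBilinComp.w = W := rfl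

end Comp

/-! ## The flag of Bläser 2003, §4 (0-indexed coordinates) -/

/-- Column `0` of a matrix, as a linear map. [cite: Blaser2003, §4] -/
def col0 : Mat3 K →ₗ[K] (Fin 3 → K) where
  toFun x i := x i 0
  map_add' _ _ := rfl
  map_smul' _ _ := rfl

/-- Columns `0, 1` of a matrix, as a linear map. [cite: Blaser2003, §4] -/
def cols01 : Mat3 K →ₗ[K] (Fin 3 → K) × (Fin 3 → K) where
  toFun x := (fun i => x i 0, fun i => x i 1)
  map_add' _ _ := rfl
  map_smul' _ _ := rfl

/-- Row `0` of a matrix, as a linear map. [cite: Blaser2003, §4] -/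
def row0 : Mat3 K →ₗ[K] (Fin 3 → K) where
  toFun x j := x 0 j
  map_add' _ _ := rfl
  map_smul' _ _ := rfl

/-- Rows `0, 1` of a matrix, as a linear map. [cite: Blaser2003, §4] -/
def rows01 : Mat3 K →ₗ[K] (Fin 3 → K) × (Fin 3 → K) where
  toFun x := (fun j => x 0 j, fun j => x 1 j)
  map_add' _ _ := rfl
  map_smul' _ _ := rfl

/-- The `(i, j)` entry, as a linear map. [folklore] -/
def entry (i j : Fin 3) : Mat3 K →ₗ[K] K where
  toFun x := x i j
  map_add' _ _ := rfl
  map_smul' _ _ := rfl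

/-- `L₁ = L₁^{3,3}`: matrices whose column `0` vanishes — the instance `colZero K 3 3 1` of
`SmallFormatRankFlag.colZero`. [cite: Blaser2003, §4] -/
def L1 : Submodule K (Mat3 K) := colZero K 3 3 1

/-- `L₂ = L₂^{3,3}`: matrices whose columns `0, 1` vanish — the instance `colZero K 3 3 2`.
[cite: Blaser2003, §4] -/
def L2 : Submodule K (Mat3 K) := colZero K 3 3 2

/-- `R = R^{3,3}`: matrices whose row `0` vanishes — the instance `rowZero K 3 3`.
[cite: Blaser2003, §4] -/
def R0 : Submodule K (Mat3 K) := rowZero K 3 3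

/-- Matrices whose rows `0, 1` vanish (`= a K^{3×3}` for `a = diag(0,0,1)`; its transpose is
`L₂`). [cite: Blaser2003, §4 (case rk a = 1)] -/
def Srow : Submodule K (Mat3 K) := LinearMap.ker rows01

/-- `Z₁ = Z₁^{3,3}`: matrices with `x₀₀ = 0` — the instance `zSub K 3 3 1`. [cite: Blaser2003, §4] -/
def Z1 : Submodule K (Mat3 K) := zSub K 3 3 1

/-- `Z₂ = Z₂^{3,3}`: matrices with column `0` zero and `x₀₁ = 0` — the instance `zSub K 3 3 2`.
[cite: Blaser2003, §4] -/
def Z2 : Submodule K (Mat3 K) := zSub K 3 3 2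

/-- `Y`: matrices with `x₀₀ = x₀₁ = 0` (the space containing `S'` in the case `rk a = 2` of
Bläser 2003, §4). [cite: Blaser2003, §4 (case rk a = 2)] -/
def Y : Submodule K (Mat3 K) := LinearMap.ker (entry 0 0) ⊓ LinearMap.ker (entry 0 1)

/-- Unfolding `col0`. [cite: Blaser2003, §4] -/
@[simp] theorem col0_apply (x : Mat3 K) (i : Fin 3) : col0 x i = x i 0 := rfl

/-- `π₄(x) = (x₁₀, x₂₀, x₁₁, x₂₁)`: on `Y`, `π₄ x = 0 ↔ x ∈ L₂`. [cite: Blaser2003, §4 (rk a = 2)] -/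
def π4 : Mat3 K →ₗ[K] (Fin 4 → K) where
  toFun x := ![x 1 0, x 2 0, x 1 1, x 2 1]
  map_add' x y := by ext i; fin_cases i <;> rfl
  map_smul' c x := by ext i; fin_cases i <;> rfl

/-- `π₂(x) = (x₁₀, x₂₀)`: on `Y`, `π₂ x = 0 ↔ x ∈ L₁`. [cite: Blaser2003, §4 (rk a = 2)] -/
def π2 : Mat3 K →ₗ[K] (Fin 2 → K) where
  toFun x := ![x 1 0, x 2 0]
  map_add' x y := by ext i; fin_cases i <;> rfl
  map_smul' c x := by ext i; fin_cases i <;> rfl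

/-- The projection `(t₀,t₁,t₂,t₃) ↦ (t₀,t₁)` with `pr42 ∘ π₄ = π₂`. [folklore] -/
def pr42 : (Fin 4 → K) →ₗ[K] (Fin 2 → K) where
  toFun t := ![t 0, t 1]
  map_add' x y := by ext i; fin_cases i <;> rfl
  map_smul' c x := by ext i; fin_cases i <;> rfl

/-- Unfolding `π₄`. [cite: Blaser2003, §4] -/
@[simp] theorem π4_apply (x : Mat3 K) : π4 x = ![x 1 0, x 2 0, x 1 1, x 2 1] := rfl
/-- Unfolding `π₂`. [cite: Blaser2003, §4] -/
@[simp] theorem π2_apply (x : Mat3 K) : π2 x = ![x 1 0, x 2 0] := rfl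
/-- Unfolding `pr42`. [folklore] -/
@[simp] theorem pr42_apply (t : Fin 4 → K) : pr42 t = ![t 0, t 1] := rfl

/-- The rank-one right ideal `R' = {v λᵀ}` as the range of `λ ↦ v λᵀ`. [folklore] -/
def rk1 (v : Fin 3 → K) : (Fin 3 → K) →ₗ[K] Mat3 K where
  toFun c := vecMulVec v c
  map_add' c d := by ext i j; simp [vecMulVec_apply, mul_add]
  map_smul' a c := by ext i j; simp [vecMulVec_apply]; ring

/-- Membership in `L₁`. [cite: Blaser2003, §4] -/
@[simp] theorem mem_L1 {x : Mat3 K} : x ∈ L1 ↔ ∀ i, x i 0 = 0 := by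
  rw [L1, mem_colZero]
  constructor
  · intro h i
    exact h i 0 (by simp)
  · intro h i j hj
    have hj0 : j = 0 := Fin.ext (by simpa using hj)
    subst hj0
    exact h i

/-- Membership in `L₂`. [cite: Blaser2003, §4] -/
@[simp] theorem mem_L2 {x : Mat3 K} : x ∈ L2 ↔ ∀ i, x i 0 = 0 ∧ x i 1 = 0 := by
  rw [L2, mem_colZero]
  constructor
  · intro h i
    exact ⟨h i 0 (by simp), h i 1 (by simp)⟩
  · intro h i j hj
    fin_cases j
    · exact (h i).1
    · exact (h i).2
    · simp at hj

/-- Membership in `R`. [cite: Blaser2003, §4] -/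
@[simp] theorem mem_R0 {x : Mat3 K} : x ∈ R0 ↔ ∀ j, x 0 j = 0 := by
  rw [R0, mem_rowZero]
  constructor
  · intro h j
    exact h 0 j rfl
  · intro h i j hi
    have hi0 : i = 0 := Fin.ext hi
    subst hi0
    exact h j

/-- Membership in `Srow`. [cite: Blaser2003, §4] -/
@[simp] theorem mem_Srow {x : Mat3 K} : x ∈ Srow ↔ ∀ j, x 0 j = 0 ∧ x 1 j = 0 := by
  simp [Srow, rows01, funext_iff, Prod.ext_iff, forall_and]

/-- Membership in `Z₁`. [cite: Blaser2003, §4] -/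
@[simp] theorem mem_Z1 {x : Mat3 K} : x ∈ Z1 ↔ x 0 0 = 0 := by
  rw [Z1, mem_zSub]
  constructor
  · intro h
    exact h.2 0 0 rfl rfl
  · intro h
    refine ⟨fun i j hj => absurd hj (by omega), fun i j hi hj => ?_⟩
    have hi0 : i = 0 := Fin.ext hi
    have hj0 : j = 0 := Fin.ext (by simpa using hj)
    subst hi0; subst hj0
    exact h

/-- Membership in `Z₂`. [cite: Blaser2003, §4] -/
@[simp] theorem mem_Z2 {x : Mat3 K} : x ∈ Z2 ↔ (∀ i, x i 0 = 0) ∧ x 0 1 = 0 := by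
  rw [Z2, mem_zSub]
  constructor
  · intro h
    exact ⟨fun i => h.1 i 0 (by simp), h.2 0 1 rfl rfl⟩
  · intro h
    refine ⟨fun i j hj => ?_, fun i j hi hj => ?_⟩
    · have hj0 : j = 0 := Fin.ext (by simp at hj; omega)
      subst hj0
      exact h.1 i
    · have hi0 : i = 0 := Fin.ext hi
      have hj1 : j = 1 := Fin.ext (by simp at hj; omega)
      subst hi0; subst hj1
      exact h.2

/-- Membership in `Y`. [cite: Blaser2003, §4] -/
@[simp] theorem mem_Y {x : Mat3 K} : x ∈ Y ↔ x 0 0 = 0 ∧ x 0 1 = 0 := by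
  simp [Y, entry]

/-- `dim K^{3×3} = 9`. [folklore] -/
theorem finrank_Mat3 : finrank K (Mat3 K) = 9 := by
  simp [Module.finrank_matrix]

end Blaser2003

end Literature.Computability.AlgebraicComplexity
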